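import Literature.AlgebraicGeometry.Resolution.HenselianElementsProofs
import Literature.AlgebraicGeometry.Resolution.HenselizationImmediateProofs
import Literature.AlgebraicGeometry.Resolution.GeneralizedStabilityHenselizedRational
import Mathlib.Algebra.Polynomial.Identities
import Mathlib.Algebra.Polynomial.Lifts
import HarnessLib

/-!
# A valued field of rank one is dense in its henselization (Kuhlmann 2010, Lemma 2.4) — proof

Topic: `Literature/AlgebraicGeometry/Resolution` (valued function fields). F.-V. Kuhlmann,
*Elimination of ramification I: The generalized stability theorem*, Trans. AMS 362 (2010)
5697–5727 = arXiv:1003.5678, §2.1: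

> **Lemma 2.4.** If `(K,v)` is a valued field of rank 1, then `K` is dense in its
> henselization. In particular, the completion of `(K,v)` is henselian.

(quoted there from general valuation theory, "[En], [R], [W], [Z–S]"; "The following lemma does
in general not hold for valuations of rank `> 1`"). It is the topological input of §4 of the
source (Lemma 4.4: "Since `(K(x),v)` is of rank 1, we know from Lemma 2.4 that it is dense in
`K(x)^h`"; Lemma 4.9; Lemmas 4.10–4.11, property (LFC1): "Since the rank of `F` is 1, the field
Quot(`R`) is dense in its henselization by Lemma 2.4"), hence of the decomposition of
`Kuhlmann2010GaloisDegreePDefectless` (Cor. 4.2) through Props. 4.12–4.13. This file PROVES the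
first assertion in the ambient rendering of `Henselization.lean` (the completion is not
rendered).

## The proof

Not the classical one through the completion (whose henselianity needs Hensel's Lemma for
complete rank-one fields), but a Newton iteration INSIDE `K`, made possible by the theorem of
Kuhlmann–Novacoski on henselian elements, discharged in the tree
(`KuhlmannNovacoski2014_Thm12_holds`, `HenselianElementsProofs.lean`): a finite subextension
`F ∋ z` of `K^h|K` is `F = K(η)` for a *Hensel root* `η` — a unit root of a monic `h` over `O_K`
with `h'(η)` a unit. Then:

* `exists_newton_step` — **the Newton step**: for `a ∈ O_K` with `v(η - a) > 0`, the
  element `a' = a - h(a)/h'(a) ∈ O_K` satisfies `v(η - a') ≥ 2·v(η - a)` (Taylor expansion of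
  `h` at `a`: `0 = h(η) = h(a) + h'(a)(η - a) + k(η - a)²`, and `h'(a)` is a unit).
* `exists_mem_valuation_sub_le_pow` — iterating from a first-order approximant `a₀ ∈ K` of `η`
  (which exists because `K^h|K` is immediate, Lemma 2.2, `HenselizationImmediateProofs.lean`):
  `v(η - aₙ) ≥ (n+1)·v(η - a₀)`.
* `exists_mem_valuation_sub_lt_of_isRankOneValued` — **Lemma 2.4**: for `(K, v)` of rank one
  (`IsRankOneValued`: the value group of `K` is archimedean), `z ∈ K^h` and `0 ≠ c ∈ K` there is
  `y ∈ K` with `v(z - y) > v(c)`: write `z = q(η)` with `q ∈ K[X]`, approximate `η` by `aₙ`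
  beyond `v(c)` (archimedean axiom) and take `y = q(aₙ)`.

Everything is PROVED, [folklore] in content; multiplicative notation (`V.valuation`, values
`< 1` are positive) throughout.

## Sources

* F.-V. Kuhlmann, Trans. AMS 362 (2010) = arXiv:1003.5678, §2.1, Lemma 2.4 (p. 5 of the arXiv
  version); §4.1 Lemma 4.4, §4.2 Lemmas 4.9–4.11 (the consumers).
* F.-V. Kuhlmann, J. Novacoski, *Henselian elements*, J. Algebra 418 (2014) = arXiv:1311.6155,
  Thm. 1.2 (the input, `KuhlmannNovacoski2014_Thm12_holds`).
-/

noncomputable section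

open IsLocalRing Polynomial

namespace Literature.AlgebraicGeometry.Resolution

universe u

variable {Ω : Type u} [Field Ω] (V : ValuationSubring Ω)

/-! ### Polynomials with coefficients in `V ∩ L` -/

section Coefficients

variable {L : Subfield Ω}

/-- A polynomial over `Ω` with coefficients in the subfield `L` evaluates into `L` at points of
`L`. [folklore] -/
theorem eval_mem_subfield_of_coeff_mem {h : Polynomial Ω} (hcoef : ∀ k, h.coeff k ∈ L) {a : Ω}
    (ha : a ∈ L) : h.eval a ∈ L := by
  rw [eval_eq_sum_range]
  exact Subfield.sum_mem _ fun k _ => L.mul_mem (hcoef k) (L.pow_mem ha k)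

/-- A polynomial over `Ω` with coefficients in the valuation ring `V` evaluates into `V` at
points of `V`. [folklore] -/
theorem eval_mem_valuationSubring_of_coeff_mem {h : Polynomial Ω} (hcoef : ∀ k, h.coeff k ∈ V)
    {a : Ω} (ha : a ∈ V) : h.eval a ∈ V := by
  rw [eval_eq_sum_range]
  exact V.toSubring.sum_mem fun k _ => V.toSubring.mul_mem (hcoef k) (V.toSubring.pow_mem ha k)

/-- The derivative of a polynomial with coefficients in `L` has coefficients in `L`. [folklore] -/
theorem coeff_derivative_mem_subfield {h : Polynomial Ω} (hcoef : ∀ k, h.coeff k ∈ L) (k : ℕ) :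
    (derivative h).coeff k ∈ L := by
  rw [coeff_derivative]
  exact L.mul_mem (hcoef (k + 1)) (L.add_mem (natCast_mem L k) L.one_mem)

/-- The derivative of a polynomial with coefficients in `V` has coefficients in `V`. [folklore] -/
theorem coeff_derivative_mem_valuationSubring {h : Polynomial Ω} (hcoef : ∀ k, h.coeff k ∈ V)
    (k : ℕ) : (derivative h).coeff k ∈ V := by
  rw [coeff_derivative]
  exact V.toSubring.mul_mem (hcoef (k + 1))
    (V.toSubring.add_mem (natCast_mem V.toSubring k) V.toSubring.one_mem)

/-- A polynomial over `Ω` with coefficients in `V` is the image of a polynomial over `V`.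
[folklore] -/
theorem exists_map_subtype_eq_of_coeff_mem {h : Polynomial Ω} (hcoef : ∀ k, h.coeff k ∈ V) :
    ∃ hV : Polynomial V, hV.map V.subtype = h := by
  have hlifts : h ∈ Polynomial.lifts (V.subtype : V →+* Ω) := by
    rw [lifts_iff_coeff_lifts]
    intro k
    exact ⟨⟨h.coeff k, hcoef k⟩, rfl⟩
  exact (mem_lifts h).mp hlifts

/-- **`v(f(x) - f(y)) ≤ v(x - y)`** for a polynomial `f` with coefficients in `V` and `x, y ∈ V`
(`x - y` divides `f(x) - f(y)` in `V`). [folklore] -/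
theorem valuation_eval_sub_eval_le {h : Polynomial Ω} (hcoef : ∀ k, h.coeff k ∈ V) {x y : Ω}
    (hx : x ∈ V) (hy : y ∈ V) : V.valuation (h.eval x - h.eval y) ≤ V.valuation (x - y) := by
  obtain ⟨hV, rfl⟩ := exists_map_subtype_eq_of_coeff_mem V hcoef
  obtain ⟨z, hz⟩ := hV.evalSubFactor ⟨x, hx⟩ ⟨y, hy⟩
  have hev : ∀ w : V, (hV.map V.subtype).eval (w : Ω) = ((hV.eval w : V) : Ω) := fun w => by
    rw [eval_map]
    exact eval₂_hom V.subtype w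
  have hx' : (hV.map V.subtype).eval x = ((hV.eval ⟨x, hx⟩ : V) : Ω) := hev ⟨x, hx⟩
  have hy' : (hV.map V.subtype).eval y = ((hV.eval ⟨y, hy⟩ : V) : Ω) := hev ⟨y, hy⟩
  have hdiff : ((hV.eval ⟨x, hx⟩ : V) : Ω) - ((hV.eval ⟨y, hy⟩ : V) : Ω) = (z : Ω) * (x - y) := by
    have := congrArg (fun w : V => (w : Ω)) hz
    simpa using this
  rw [hx', hy', hdiff, map_mul]
  have hzle : V.valuation (z : Ω) ≤ 1 := (V.valuation_le_one_iff _).mpr z.2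
  calc V.valuation (z : Ω) * V.valuation (x - y) ≤ 1 * V.valuation (x - y) :=
      mul_le_mul' hzle le_rfl
    _ = V.valuation (x - y) := one_mul _

end Coefficients

/-! ### The Newton step -/

section Newton

variable {L : Subfield Ω}

/-- **The Newton step towards a Hensel root.** Let `h ∈ Ω[X]` have coefficients in `V ∩ L`, let
`η ∈ V` be a root of `h` with `v(h'(η)) = 1` (multiplicatively: `h'(η)` is a unit), and let
`a ∈ V ∩ L` with `v(η - a) < 1`. Then `a' = a - h(a)/h'(a)` lies in `V ∩ L` and
`v(η - a') ≤ v(η - a)²`. Proof: `h'(a) ≡ h'(η)` modulo `η - a`, so `h'(a)` is a unit; by Taylor,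
`0 = h(η) = h(a) + h'(a)(η - a) + k(η - a)²` with `k ∈ V`, whence
`η - a' = -k(η - a)²/h'(a)`. [folklore] -/
theorem exists_newton_step {h : Polynomial Ω} (hcoefV : ∀ k, h.coeff k ∈ V)
    (hcoefL : ∀ k, h.coeff k ∈ L) {η : Ω} (hηV : η ∈ V) (hroot : h.eval η = 0)
    (hder : V.valuation ((derivative h).eval η) = 1) {a : Ω} (haL : a ∈ L) (haV : a ∈ V)
    (hlt : V.valuation (η - a) < 1) :
    ∃ a' ∈ L, a' ∈ V ∧ V.valuation (η - a') ≤ V.valuation (η - a) ^ 2 := by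
  -- `h'(a)` is a unit of `V`
  have hdercoefV : ∀ k, (derivative h).coeff k ∈ V := coeff_derivative_mem_valuationSubring V hcoefV
  have hder_a : V.valuation ((derivative h).eval a) = 1 := by
    have h1 : V.valuation ((derivative h).eval a - (derivative h).eval η) < 1 :=
      lt_of_le_of_lt (valuation_eval_sub_eval_le V hdercoefV haV hηV)
        (by rwa [← Valuation.map_neg, neg_sub])
    have h2 : (derivative h).eval a = ((derivative h).eval a - (derivative h).eval η) +
        (derivative h).eval η := by ring
    rw [h2, Valuation.map_add_eq_of_lt_right, hder]
    rwa [hder]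
  have hder_a0 : (derivative h).eval a ≠ 0 := by
    intro h0
    rw [h0, map_zero] at hder_a
    exact zero_ne_one hder_a
  -- Taylor expansion of `h` at `a` in `V`
  obtain ⟨hV, hhV⟩ := exists_map_subtype_eq_of_coeff_mem V hcoefV
  have hdV : η - a ∈ V := (V.valuation_le_one_iff _).mp hlt.le
  obtain ⟨k, hk⟩ := hV.binomExpansion ⟨a, haV⟩ ⟨η - a, hdV⟩
  -- transport the expansion to `Ω`
  have hevalΩ : ∀ x : V, ((hV.eval x : V) : Ω) = h.eval (x : Ω) := fun x => by
    rw [← hhV, eval_map]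
    exact (eval₂_hom V.subtype x).symm
  have hderΩ : ∀ x : V, (((derivative hV).eval x : V) : Ω) = (derivative h).eval (x : Ω) := fun x => by
    rw [← hhV, derivative_map, eval_map]
    exact (eval₂_hom V.subtype x).symm
  have hsum : ((⟨a, haV⟩ : V) + ⟨η - a, hdV⟩ : V) = ⟨η, hηV⟩ := Subtype.ext (by simp)
  have hkΩ : (0 : Ω) = h.eval a + (derivative h).eval a * (η - a) + (k : Ω) * (η - a) ^ 2 := by
    have := congrArg (fun x : V => (x : Ω)) hk
    simp only [hsum, hevalΩ, hderΩ, V.coe_add, V.coe_mul, V.coe_pow] at this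
    rw [hroot] at this
    exact this
  -- the new approximant
  set a' : Ω := a - h.eval a / (derivative h).eval a with ha'
  have hηa' : η - a' = -(k : Ω) * (η - a) ^ 2 / (derivative h).eval a := by
    rw [ha']
    field_simp
    linear_combination -hkΩ
  refine ⟨a', ?_, ?_, ?_⟩
  · -- `a' ∈ L`
    exact L.sub_mem haL (L.div_mem (eval_mem_subfield_of_coeff_mem hcoefL haL)
      (eval_mem_subfield_of_coeff_mem (coeff_derivative_mem_subfield hcoefL) haL))
  · -- `a' ∈ V`: `a' = η + k(η - a)²/h'(a)`
    have h1 : a' = η - (η - a') := by ring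
    have hmem : -(k : Ω) * (η - a) ^ 2 / (derivative h).eval a ∈ V := by
      rw [← V.valuation_le_one_iff, map_div₀, hder_a, div_one, map_mul, Valuation.map_neg, map_pow]
      exact mul_le_one' ((V.valuation_le_one_iff _).mpr k.2) (pow_le_one' hlt.le 2)
    rw [h1, hηa']
    exact V.toSubring.sub_mem hηV hmem
  · -- the estimate
    rw [hηa', map_div₀, hder_a, div_one, map_mul, Valuation.map_neg, map_pow]
    calc V.valuation (k : Ω) * V.valuation (η - a) ^ 2 ≤ 1 * V.valuation (η - a) ^ 2 :=
        mul_le_mul' ((V.valuation_le_one_iff _).mpr k.2) le_rfl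
      _ = V.valuation (η - a) ^ 2 := one_mul _

/-- **Newton iteration**: from an approximant `a₀ ∈ V ∩ L` with `ε = v(η - a₀) < 1`, for every
`n` there is `a ∈ V ∩ L` with `v(η - a) ≤ ε^(n+1)`. [folklore] -/
theorem exists_mem_valuation_sub_le_pow {h : Polynomial Ω} (hcoefV : ∀ k, h.coeff k ∈ V)
    (hcoefL : ∀ k, h.coeff k ∈ L) {η : Ω} (hηV : η ∈ V) (hroot : h.eval η = 0)
    (hder : V.valuation ((derivative h).eval η) = 1) {a₀ : Ω} (ha₀L : a₀ ∈ L) (ha₀V : a₀ ∈ V)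
    (hlt : V.valuation (η - a₀) < 1) (n : ℕ) :
    ∃ a ∈ L, a ∈ V ∧ V.valuation (η - a) ≤ V.valuation (η - a₀) ^ (n + 1) := by
  induction n with
  | zero => exact ⟨a₀, ha₀L, ha₀V, by rw [zero_add, pow_one]⟩
  | succ n ih =>
    obtain ⟨a, haL, haV, hle⟩ := ih
    have hlt' : V.valuation (η - a) < 1 :=
      lt_of_le_of_lt hle (pow_lt_one₀ zero_le hlt (Nat.succ_ne_zero n))
    obtain ⟨a', ha'L, ha'V, hle'⟩ := exists_newton_step V hcoefV hcoefL hηV hroot hder haL haV hlt'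
    refine ⟨a', ha'L, ha'V, hle'.trans ?_⟩
    calc V.valuation (η - a) ^ 2 ≤ (V.valuation (η - a₀) ^ (n + 1)) ^ 2 :=
        pow_le_pow_left₀ zero_le hle 2
      _ = V.valuation (η - a₀) ^ (2 * (n + 1)) := by rw [← pow_mul, mul_comm]
      _ ≤ V.valuation (η - a₀) ^ (n + 1 + 1) :=
        pow_le_pow_of_le_one zero_le hlt.le (by omega)

end Newton

/-! ### Lemma 2.4 -/

section Density

variable {V}

/-- **`v(q(η) - q(a)) ≤ max_i v(bᵢ) · v(η - a)`** for `q = Σ bᵢ Xⁱ` over `L` and `η, a ∈ V`: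
each `ηⁱ - aⁱ` is divisible by `η - a` in `V`. Here with the bound `B` on the values of the
coefficients as a hypothesis. [folklore] -/
theorem valuation_aeval_sub_aeval_le {L : Subfield Ω} (q : Polynomial L) {B : ValuationSubring.ValueGroup V}
    (hB : ∀ i, V.valuation (algebraMap L Ω (q.coeff i)) ≤ B) {η a : Ω} (hη : η ∈ V)
    (ha : a ∈ V) : V.valuation (aeval η q - aeval a q) ≤ B * V.valuation (η - a) := by
  rw [aeval_def, aeval_def, eval₂_eq_sum_range, eval₂_eq_sum_range, ← Finset.sum_sub_distrib]
  refine Valuation.map_sum_le _ fun i _ => ?_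
  rw [← mul_sub, map_mul]
  refine mul_le_mul' (hB i) ?_
  obtain ⟨z, hz⟩ := Polynomial.powSubPowFactor (⟨η, hη⟩ : V) ⟨a, ha⟩ i
  have hzΩ : η ^ i - a ^ i = (z : Ω) * (η - a) := by
    have := congrArg (fun x : V => (x : Ω)) hz
    simpa using this
  rw [hzΩ, map_mul]
  calc V.valuation (z : Ω) * V.valuation (η - a) ≤ 1 * V.valuation (η - a) :=
      mul_le_mul' ((V.valuation_le_one_iff _).mpr z.2) le_rfl
    _ = V.valuation (η - a) := one_mul _

/-- **Kuhlmann 2010, Lemma 2.4: a valued field of rank one is dense in its henselization.**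
For `Ω` algebraically closed with valuation ring `V`, a subfield `L` whose valuation `V ∩ L` has
rank one (`IsRankOneValued V L`: some element of `L` has value `> 1`, and the values of `L` are
archimedean), an element `z` of the henselization `L^h = henselization V L` and `0 ≠ c ∈ L`,
there is `y ∈ L` with `v(z - y) < v(c)`. Proof: `L(z) ⊆ L^h` is `L(η)` for a Hensel root `η`
over `O_L` (Kuhlmann–Novacoski, Thm. 1.2, `KuhlmannNovacoski2014_Thm12_holds`); `z = q(η)` with
`q ∈ L[X]`; a first-order approximant `a₀ ∈ L` of `η` exists as `L^h|L` is immediate (Lemma 2.2),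
the Newton iterates `aₙ ∈ L` satisfy `v(η - aₙ) ≤ v(η - a₀)^(n+1)`, which the archimedean axiom
pushes below any value of `L`; `y = q(aₙ)`. PROVED. [cite: Kuhlmann2010, Lemma 2.4] -/
theorem exists_mem_valuation_sub_lt_of_isRankOneValued [IsAlgClosed Ω] {L : Subfield Ω}
    (hL : IsRankOneValued V L) {z : Ω} (hz : z ∈ henselization V L) {c : Ω} (hc : c ∈ L)
    (hc0 : c ≠ 0) : ∃ y ∈ L, V.valuation (z - y) < V.valuation c := by
  classical
  have hvc : 0 < V.valuation c := (Valuation.pos_iff _).mpr hc0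
  -- the finite subextension `F = L(z)` of `L^h|L`
  set F : Subfield Ω := Subfield.closure ((L : Set Ω) ∪ {z}) with hF
  have hLF : L ≤ F := fun y hy => Subfield.subset_closure (Or.inl hy)
  have hzF : z ∈ F := Subfield.subset_closure (Or.inr rfl)
  have hFh : F ≤ henselization V L := by
    rw [hF, Subfield.closure_le]
    rintro y (hy | hy)
    · exact le_henselization V L hy
    · rw [Set.mem_singleton_iff] at hy
      rw [hy]
      exact hz
  have hfg : FGOver L F := ⟨{z}, by rw [Finset.coe_singleton]⟩
  have hfin : FiniteOver L F := finiteOver_of_fgOver_of_le_henselization V hfg hFh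
  -- a Hensel root `η` generating `F`
  obtain ⟨η, hηF, hvη, hgen, h, -, hcoef, hroot, -, hder⟩ :=
    KuhlmannNovacoski2014_Thm12_holds Ω V L F hLF hfin hFh
  have hηV : η ∈ V := (V.valuation_le_one_iff η).mp hvη.le
  have hη0 : η ≠ 0 := by
    intro h0
    rw [h0, map_zero] at hvη
    exact zero_ne_one hvη
  have hcoefV : ∀ k, h.coeff k ∈ V := fun k => (hcoef k).1
  have hcoefL : ∀ k, h.coeff k ∈ L := fun k => (hcoef k).2
  -- `η` is integral over `L`: `h` comes from a polynomial over `L`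
  have hlifts : h ∈ Polynomial.lifts (algebraMap L Ω) := by
    rw [lifts_iff_coeff_lifts]
    intro k
    exact ⟨⟨h.coeff k, hcoefL k⟩, rfl⟩
  obtain ⟨hL', hhL'⟩ := (mem_lifts h).mp hlifts
  have halg : IsAlgebraic L η := by
    have hne : h ≠ 0 := by
      intro h0
      rw [h0, derivative_zero, eval_zero, map_zero] at hder
      exact zero_ne_one hder
    have hL'ne : hL' ≠ 0 := by
      intro h0
      rw [h0, Polynomial.map_zero] at hhL'
      exact hne hhL'.symm
    exact ⟨hL', hL'ne, by rw [aeval_def, ← eval_map, hhL', hroot]⟩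
  -- `z = q(η)` for some `q ∈ L[X]`
  have hzadj : z ∈ IntermediateField.adjoin L ({η} : Set Ω) := by
    rw [mem_adjoin_subfield_iff, hgen]
    exact hzF
  have hzalg : z ∈ Algebra.adjoin L ({η} : Set Ω) := by
    rw [← IntermediateField.adjoin_simple_toSubalgebra_of_isAlgebraic halg]
    exact hzadj
  rw [Algebra.adjoin_singleton_eq_range_aeval] at hzalg
  obtain ⟨q, rfl⟩ := hzalg
  -- the case `q = 0` is trivial
  by_cases hq : q = 0
  · refine ⟨0, L.zero_mem, ?_⟩
    rw [hq, map_zero, sub_zero, map_zero]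
    exact hvc
  -- a coefficient `b₀` of `q` of largest value `B`
  have hsupp : q.support.Nonempty := Polynomial.support_nonempty.mpr hq
  obtain ⟨i₀, hi₀, hB⟩ := Finset.exists_mem_eq_sup' hsupp
    (fun i => V.valuation (algebraMap L Ω (q.coeff i)))
  set B := q.support.sup' hsupp (fun i => V.valuation (algebraMap L Ω (q.coeff i))) with hBdef
  set b₀ : Ω := algebraMap L Ω (q.coeff i₀) with hb₀
  have hb₀L : b₀ ∈ L := (q.coeff i₀).2
  have hb₀0 : b₀ ≠ 0 := by
    rw [hb₀, Ne, map_eq_zero_iff _ (algebraMap L Ω).injective]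
    exact Polynomial.mem_support_iff.mp hi₀
  have hBb₀ : B = V.valuation b₀ := hB
  have hBle : ∀ i, V.valuation (algebraMap L Ω (q.coeff i)) ≤ B := by
    intro i
    by_cases hi : i ∈ q.support
    · exact Finset.le_sup' (fun i => V.valuation (algebraMap L Ω (q.coeff i))) hi
    · rw [Polynomial.notMem_support_iff.mp hi, map_zero, map_zero]
      exact zero_le
  -- target precision for `η`: `v(η - a) < v(c / b₀)`
  set c' : Ω := c / b₀ with hc'
  have hc'L : c' ∈ L := L.div_mem hc hb₀L
  have hc'0 : c' ≠ 0 := div_ne_zero hc0 hb₀0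
  have hvc' : 0 < V.valuation c' := (Valuation.pos_iff _).mpr hc'0
  -- a first-order approximant `a₀ ∈ L` of `η`
  obtain ⟨a₀, ha₀L, ha₀⟩ := exists_mem_valuation_sub_lt_of_mem_henselization V L (hFh hηF) hη0
  rw [hvη] at ha₀
  have ha₀V : a₀ ∈ V := by
    have h1 : a₀ = η - (η - a₀) := by ring
    rw [h1]
    exact V.sub_mem hηV ((V.valuation_le_one_iff _).mp ha₀.le)
  -- approximate `η` beyond `v(c')`
  obtain ⟨a, haL, haV, ha⟩ : ∃ a ∈ L, a ∈ V ∧ V.valuation (η - a) < V.valuation c' := by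
    by_cases hε : V.valuation (η - a₀) = 0
    · exact ⟨a₀, ha₀L, ha₀V, by rw [hε]; exact hvc'⟩
    · -- `ε = v(η - a₀) = v(e)` for some `e ∈ L` (the henselization is immediate)
      have hεpos : 0 < V.valuation (η - a₀) := lt_of_le_of_ne zero_le (Ne.symm hε)
      have hηa₀h : η - a₀ ∈ henselization V L :=
        (henselization V L).sub_mem (hFh hηF) (le_henselization V L ha₀L)
      have hηa₀0 : η - a₀ ≠ 0 := fun h0 => hε (by rw [h0, map_zero])
      obtain ⟨e, heL, he⟩ :=
        (Kuhlmann2010HenselizationImmediate_holds Ω V L).1 (η - a₀) hηa₀h hηa₀0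
      have he0 : e ≠ 0 := by
        intro h0
        rw [h0, map_zero] at he
        exact hε he
      -- archimedean axiom: `v(c'⁻¹) ≤ v(e⁻¹)^n`, i.e. `ε^n ≤ v(c')`
      have hve : 1 < V.valuation e⁻¹ := by
        rw [map_inv₀, ← he]
        exact one_lt_inv_iff₀.mpr ⟨hεpos, ha₀⟩
      obtain ⟨n, hn⟩ := hL.2 e⁻¹ (L.inv_mem heL) c'⁻¹ (L.inv_mem hc'L) hve
      rw [map_inv₀, map_inv₀, ← he, inv_pow, inv_le_inv₀ hvc' (pow_pos hεpos n)] at hn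
      -- Newton iteration to precision `ε^(n+1) < ε^n ≤ v(c')`
      obtain ⟨a, haL, haV, hle⟩ :=
        exists_mem_valuation_sub_le_pow V hcoefV hcoefL hηV hroot hder ha₀L ha₀V ha₀ n
      refine ⟨a, haL, haV, lt_of_le_of_lt hle (lt_of_lt_of_le ?_ hn)⟩
      exact pow_lt_pow_right_of_lt_one₀ hεpos ha₀ (Nat.lt_succ_self n)
  -- `y = q(a)`
  refine ⟨aeval a q, ?_, ?_⟩
  · have : aeval a q = algebraMap L Ω (q.eval ⟨a, haL⟩) := by
      rw [aeval_def, ← eval_map, ← Polynomial.eval₂_hom, eval_map]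
      rfl
    rw [this]
    exact (q.eval ⟨a, haL⟩).2
  · calc V.valuation (aeval η q - aeval a q) ≤ B * V.valuation (η - a) :=
        valuation_aeval_sub_aeval_le q hBle hηV haV
      _ < B * V.valuation c' := by
        rw [hBb₀]
        exact mul_lt_mul_of_pos_left ha ((Valuation.pos_iff _).mpr hb₀0)
      _ = V.valuation c := by
        rw [hBb₀, hc', map_div₀, mul_div_cancel₀ _ ((Valuation.ne_zero_iff _).mpr hb₀0)]

end Density

end Literature.AlgebraicGeometry.Resolution
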